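import Literature.Analysis.SegalBargmann.FockStoneClosure
import Literature.Analysis.UnboundedOperators.UnitaryRep

/-!
# Stone's theorem for `t ↦ ν₀(e^{tX})`, `X ∈ 𝔲(n)`, in the `Literature.Analysis.UnboundedOperators` vocabulary (after Folland 1989, Ch. 4 §4)

Source followed: G. B. Folland, *Harmonic Analysis in Phase Space*, Ch. 4 §4, cited by item; built on
`FockStoneClosure` and the DEFINITIONS of `Literature.Analysis.UnboundedOperators.UnitaryRep` (`UnitaryRep`,
`OneParameterUnitaryGroup`, `OneParameterGroup.generator`, `UnitaryRep.hamiltonian`).  NONE of that file's named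
facts (`isSelfAdjoint_hamiltonian`, `mem_generator_domain_iff_two_sided`, `dense_generator_domain`,
`isClosed_generator`, …) is used as a hypothesis — their conclusions are PROVED here for the concrete groups of this
directory.  Hypotheses are `[Fintype σ] [DecidableEq σ]` and the displayed `star X = -X`; no cited facts.

Folland Ch. 4 §4 (before Thm (4.45)) takes `dμ(𝒜) = d/dt μ(e^{t𝒜})|_{t=0}` on "the space of all `f ∈ L²` such that
`t^{-1}[μ(e^{t𝒜}) − I]f` converges in the `L²` norm as `t → 0`"; Prop (4.43) / Thm (4.45) make `dμ` a representation
by (essentially) skew-Hermitian operators.  For the compact directions in the Fock model (Prop (4.39)):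

1. (§1) `fockGroup hX : OneParameterUnitaryGroup (FockL2 σ)` = `t ↦ ν₀(e^{tX})` (group law from `FockOneParameter`,
   strong continuity from `FockStoneGenerator`; `appReal` is `rfl`).
2. (§2) a right limit of `t⁻¹(U(t)x − x)` at `0` is a two-sided one (`hasDerivAt_fockRep_expUnitary_of_tendsto_Ioi`).
3. (§3) **the abstract generator IS the explicit generator**: `OneParameterGroup.generator (fockGroup hX) = genPMap hX`
   as partially defined operators (`genPMap hX := ⟨genDom hX, genOp hX⟩ : FockL2 σ →ₗ.[ℂ] FockL2 σ`), hence
   `(fockGroup hX).hamiltonian = (−i) • genPMap hX`, with domain `genDom hX` (the finite-energy vectors of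
   `FockStoneGenerator`).
4. (§4) for THIS group, the conclusions of the general facts: dense domain, closed generator (`FockStoneClosure`),
   domain membership iff the TWO-sided quotient converges (and it converges to the generator),
   `hamiltonian_apply_of_hasDerivAt`.
5. (§5) **Stone's theorem (generator half) for `t ↦ ν₀(e^{tX})`**: `IsSelfAdjoint (fockGroup hX).hamiltonian`
   (Mathlib's `LinearPMap.adjoint`; from the skew-symmetry of `FockStoneGenerator` + `mem_genDom_of_forall_inner_genDom`
   of `FockStoneClosure`), hence symmetric and closed.

## What is NOT in this file

Compact directions `X ∈ 𝔲(σ)` only; this is Stone's theorem for THESE concrete groups, via the explicit spectral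
resolution of `FockCompactDiagonal` / `FockStoneGenerator` — not the general theorem.  The general versions of §4–§5
for an arbitrary `OneParameterUnitaryGroup` are theorems elsewhere in this directory's sibling
(`UnitaryRepProofs`: `isSelfAdjoint_hamiltonian_holds`, `hamiltonian_apply_of_hasDerivAt_holds`,
`dense_hamiltonian_domain`; `StrongContRepresentation{,Closed,Density}Proofs`: `tendsto_generator_two_sided_holds`,
`mem_generator_domain_iff_two_sided_holds`, `isClosed_generator_holds`, `dense_generator_domain_holds`); here §4–§5
are proved directly from the explicit generator and import none of those files.  The content specific to this file
is §§1–3 (the construction and the EXPLICIT identification `generator = genPMap`, domain = the finite-energy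
vectors), which the general theorems do not give.

## References

* [Folland1989] G. B. Folland, *Harmonic Analysis in Phase Space*, Annals of Mathematics Studies 122, Princeton
  University Press, 1989, Ch. 4 §4 (Prop (4.39), Prop (4.43), Thm (4.45)) (doi:10.1515/9781400882427).
* M. H. Stone, *On one-parameter unitary groups in Hilbert space*, Ann. of Math. 33 (1932) 643–648 (context only).

Filed under the LEAN-IN-TREE rule (2026-08-18) by seat pv05-g8 from the HodgeCM/PerL working package file
`HodgeCM/PerL34/FockStoneHamiltonian.lean` (origin seat pv05-g7); statements and proofs unchanged, the package's
vendored copy of `UnitaryRep` replaced by the original `Literature.Analysis.UnboundedOperators.UnitaryRep`; namespace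
`HodgeCM.PerL34.Fock.Hermite` ↦ `Literature.Analysis.SegalBargmann`.
-/

noncomputable section

namespace Literature.Analysis.SegalBargmann

open Complex Matrix Filter Topology
open scoped ComplexConjugate InnerProductSpace NNReal
open Literature.Analysis.UnboundedOperators

/- All inner products below are the Hilbert-space ones of `FockL2 σ` (see the note in `FockLadderAdjoint`). -/
attribute [local instance 10000] InnerProductSpace.toInner

variable {σ : Type*} [Fintype σ] [DecidableEq σ]

omit [DecidableEq σ] in
/-- Real scalars act through `ℂ` on `FockL2 σ`. [folklore] -/
private theorem rsmul (r : ℝ) (z : FockL2 σ) : r • z = (r : ℂ) • z :=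
  (Complex.coe_smul r z).symm

/-! ## §1  `t ↦ ν₀(e^{tX})` as a `OneParameterUnitaryGroup` -/

/-- `t ↦ e^{tX}` as a monoid homomorphism `Multiplicative ℝ →* U(σ)` (`expUnitary_zero`, `expUnitary_add` of `FockOneParameter`).
[folklore] -/
def expUnitaryHom {X : Matrix σ σ ℂ} (hX : star X = -X) : Multiplicative ℝ →* Matrix.unitaryGroup σ ℂ where
  toFun t := expUnitary X hX (Multiplicative.toAdd t)
  map_one' := by rw [toAdd_one, expUnitary_zero]
  map_mul' s t := by rw [toAdd_mul, expUnitary_add]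

/-- Unfolding of `expUnitaryHom`. [folklore] -/
@[simp]
theorem expUnitaryHom_apply {X : Matrix σ σ ℂ} (hX : star X = -X) (t : Multiplicative ℝ) :
    expUnitaryHom hX t = expUnitary X hX (Multiplicative.toAdd t) := rfl

/-- `t ↦ ν₀(e^{tX})` as a monoid homomorphism into the bounded operators of `𝓕_σ`
(through Mathlib's `Unitary.linearIsometryEquiv : unitary (H →L[ℂ] H) ≃* (H ≃ₗᵢ[ℂ] H)`).
[folklore] -/
def fockGroupHom {X : Matrix σ σ ℂ} (hX : star X = -X) : Multiplicative ℝ →* (FockL2 σ →L[ℂ] FockL2 σ) :=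
  ((unitary (FockL2 σ →L[ℂ] FockL2 σ)).subtype.comp
      (Unitary.linearIsometryEquiv (𝕜 := ℂ) (H := FockL2 σ)).symm.toMonoidHom).comp
    (fockRep.comp (expUnitaryHom hX))

/-- Unfolding of `fockGroupHom` as a bounded operator. [folklore] -/
theorem fockGroupHom_apply {X : Matrix σ σ ℂ} (hX : star X = -X) (t : Multiplicative ℝ) :
    fockGroupHom hX t
      = ((fockRep (expUnitary X hX (Multiplicative.toAdd t)) : FockL2 σ ≃ₗᵢ[ℂ] FockL2 σ) :
          FockL2 σ →L[ℂ] FockL2 σ) := rfl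

/-- `fockGroupHom hX t v = ν₀(e^{tX}) v`. [folklore] -/
@[simp]
theorem fockGroupHom_apply_apply {X : Matrix σ σ ℂ} (hX : star X = -X) (t : Multiplicative ℝ) (v : FockL2 σ) :
    fockGroupHom hX t v = fockRep (expUnitary X hX (Multiplicative.toAdd t)) v := rfl

/-- Each `fockGroupHom hX t` is a unitary operator. [folklore] -/
theorem fockGroupHom_mem_unitary {X : Matrix σ σ ℂ} (hX : star X = -X) (t : Multiplicative ℝ) :
    fockGroupHom hX t ∈ unitary (FockL2 σ →L[ℂ] FockL2 σ) :=
  (Unitary.linearIsometryEquiv.symm (fockRep (expUnitary X hX (Multiplicative.toAdd t)))).2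

/-- **The strongly continuous one-parameter unitary group `t ↦ ν₀(e^{tX})` on `𝓕_σ`**, `X ∈ 𝔲(σ)`, as a term of the
`Literature.Analysis.UnboundedOperators.OneParameterUnitaryGroup (FockL2 σ)`
(= `UnitaryRep (Multiplicative ℝ) (FockL2 σ)`); strong continuity is `continuous_fockRep_expUnitary_apply` (`FockStoneGenerator`).
[folklore] -/
def fockGroup {X : Matrix σ σ ℂ} (hX : star X = -X) : OneParameterUnitaryGroup (FockL2 σ) where
  toMonoidHom := fockGroupHom hX
  strongly_continuous v :=
    ((continuous_fockRep_expUnitary_apply hX v).comp continuous_toAdd).congr fun _ => rfl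
  mem_unitary t := fockGroupHom_mem_unitary hX t

/-- Unfolding: the underlying homomorphism of `fockGroup hX` is `fockGroupHom hX`. [folklore] -/
@[simp]
theorem fockGroup_apply {X : Matrix σ σ ℂ} (hX : star X = -X) (g : Multiplicative ℝ) :
    fockGroup hX g = fockGroupHom hX g := rfl

/-- `U(t) v = ν₀(e^{tX}) v` for the time-`t` operator `UnitaryRep.appReal`. [folklore] -/
@[simp]
theorem fockGroup_appReal_apply {X : Matrix σ σ ℂ} (hX : star X = -X) (t : ℝ) (v : FockL2 σ) :
    (fockGroup hX).appReal t v = fockRep (expUnitary X hX t) v := rfl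

/-- `U(t) v = ν₀(e^{tX}) v` for `OneParameterGroup.app` of the underlying one-parameter group.
[folklore] -/
@[simp]
theorem fockGroup_app_apply {X : Matrix σ σ ℂ} (hX : star X = -X) (t : ℝ) (v : FockL2 σ) :
    OneParameterGroup.app (fockGroup hX).toStrongContRepresentation t v = fockRep (expUnitary X hX t) v := rfl

/-- The forward semigroup's `T(t⁺) v = ν₀(e^{(max t 0) X}) v`. [folklore] -/
theorem fockGroup_toC0Semigroup_app_apply {X : Matrix σ σ ℂ} (hX : star X = -X) (t : ℝ) (v : FockL2 σ) :
    (OneParameterGroup.toC0Semigroup (fockGroup hX).toStrongContRepresentation).app t.toNNReal v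
      = fockRep (expUnitary X hX (max t 0)) v := rfl

/-! ## §2  One-sided versus two-sided difference quotients -/

/-- Joint continuity at `t = 0`: if `a(t) → b` along a filter finer than `𝓝 0` then `ν₀(e^{tX}) a(t) → b` along it
(strong continuity, `FockStoneGenerator`, + isometry). [folklore] -/
theorem tendsto_fockRep_expUnitary_apply_of_tendsto_filter {X : Matrix σ σ ℂ} (hX : star X = -X) {l : Filter ℝ}
    (hl : l ≤ 𝓝 0) {a : ℝ → FockL2 σ} {b : FockL2 σ} (ha : Tendsto a l (𝓝 b)) :
    Tendsto (fun t : ℝ => fockRep (expUnitary X hX t) (a t)) l (𝓝 b) := by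
  rw [tendsto_iff_norm_sub_tendsto_zero] at ha ⊢
  have h2 : Tendsto (fun t : ℝ => ‖fockRep (expUnitary X hX t) b - b‖) l (𝓝 0) := by
    have h := (tendsto_fockRep_expUnitary_zero hX b).mono_left hl
    rw [tendsto_iff_norm_sub_tendsto_zero] at h
    exact h
  have hsum := ha.add h2
  rw [add_zero] at hsum
  refine squeeze_zero (fun t => norm_nonneg _) (fun t => ?_) hsum
  calc ‖fockRep (expUnitary X hX t) (a t) - b‖
      ≤ ‖fockRep (expUnitary X hX t) (a t) - fockRep (expUnitary X hX t) b‖ + ‖fockRep (expUnitary X hX t) b - b‖ :=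
        norm_sub_le_norm_sub_add_norm_sub _ _ _
    _ = ‖a t - b‖ + ‖fockRep (expUnitary X hX t) b - b‖ := by rw [← map_sub, LinearIsometryEquiv.norm_map]

/-- Reflection of the difference quotient: `t⁻¹(U(t)x − x) = U(t) ((−t)⁻¹(U(−t)x − x))`.
[folklore] -/
theorem quot_fockRep_expUnitary_reflect {X : Matrix σ σ ℂ} (hX : star X = -X) (x : FockL2 σ) (t : ℝ) :
    ((t⁻¹ : ℝ) : ℂ) • (fockRep (expUnitary X hX t) x - x)
      = fockRep (expUnitary X hX t) ((((-t)⁻¹ : ℝ) : ℂ) • (fockRep (expUnitary X hX (-t)) x - x)) := by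
  rw [map_smul, map_sub, fockRep_expUnitary_fockRep_expUnitary_neg, inv_neg, Complex.ofReal_neg, neg_smul, ← smul_neg,
    neg_sub]

/-- The difference quotient in Mathlib's `hasDerivAt_iff_tendsto_slope_zero` form equals the `ℂ`-scalar form.
[folklore] -/
private theorem slope_eq {X : Matrix σ σ ℂ} (hX : star X = -X) (x : FockL2 σ) (t : ℝ) :
    t⁻¹ • (fockRep (expUnitary X hX (0 + t)) x - fockRep (expUnitary X hX 0) x)
      = ((t⁻¹ : ℝ) : ℂ) • (fockRep (expUnitary X hX t) x - x) := by
  rw [zero_add, expUnitary_zero, map_one, LinearIsometryEquiv.coe_one, id_eq, rsmul]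

/-- `d/dt|₀ ν₀(e^{tX}) x = y` iff the two-sided quotient `t⁻¹(ν₀(e^{tX})x − x) → y` (`t → 0`, `t ≠ 0`).
[folklore] -/
theorem hasDerivAt_fockRep_expUnitary_iff_tendsto {X : Matrix σ σ ℂ} (hX : star X = -X) (x y : FockL2 σ) :
    HasDerivAt (fun t : ℝ => fockRep (expUnitary X hX t) x) y 0 ↔
      Tendsto (fun t : ℝ => ((t⁻¹ : ℝ) : ℂ) • (fockRep (expUnitary X hX t) x - x)) (𝓝[≠] 0) (𝓝 y) := by
  rw [hasDerivAt_iff_tendsto_slope_zero]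
  exact ⟨fun h => h.congr fun t => slope_eq hX x t, fun h => h.congr fun t => (slope_eq hX x t).symm⟩

/-- **Right-differentiability at `0` is two-sided differentiability** for the unitary group `t ↦ ν₀(e^{tX})`:
if `t⁻¹(ν₀(e^{tX})x − x) → y` as `t ↓ 0` then `d/dt|₀ ν₀(e^{tX}) x = y`. [folklore] -/
theorem hasDerivAt_fockRep_expUnitary_of_tendsto_Ioi {X : Matrix σ σ ℂ} (hX : star X = -X) {x y : FockL2 σ}
    (h : Tendsto (fun t : ℝ => ((t⁻¹ : ℝ) : ℂ) • (fockRep (expUnitary X hX t) x - x)) (𝓝[>] 0) (𝓝 y)) :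
    HasDerivAt (fun t : ℝ => fockRep (expUnitary X hX t) x) y 0 := by
  rw [hasDerivAt_fockRep_expUnitary_iff_tendsto, ← nhdsLT_sup_nhdsGT]
  refine Tendsto.sup ?_ h
  have hneg : Tendsto (fun t : ℝ => -t) (𝓝[<] (0 : ℝ)) (𝓝[>] 0) := by
    refine tendsto_nhdsWithin_of_tendsto_nhds_of_eventually_within _ ?_ ?_
    · exact (continuous_neg.tendsto' (0 : ℝ) 0 neg_zero).mono_left nhdsWithin_le_nhds
    · filter_upwards [self_mem_nhdsWithin] with t ht
      exact Set.mem_Ioi.mpr (neg_pos.mpr ht)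
  have h1 : Tendsto (fun t : ℝ => (((-t)⁻¹ : ℝ) : ℂ) • (fockRep (expUnitary X hX (-t)) x - x)) (𝓝[<] 0) (𝓝 y) :=
    h.comp hneg
  exact (tendsto_fockRep_expUnitary_apply_of_tendsto_filter hX nhdsWithin_le_nhds h1).congr fun t =>
    (quot_fockRep_expUnitary_reflect hX x t).symm

/-- The forward-semigroup quotient `OneParameterGroup`-style agrees with the plain quotient for `t > 0`.
[folklore] -/
theorem toC0Semigroup_quot_eventuallyEq {X : Matrix σ σ ℂ} (hX : star X = -X) (x : FockL2 σ) :
    (fun t : ℝ => ((t⁻¹ : ℝ) : ℂ) •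
        ((OneParameterGroup.toC0Semigroup (fockGroup hX).toStrongContRepresentation).app t.toNNReal x - x))
      =ᶠ[𝓝[>] 0] fun t => ((t⁻¹ : ℝ) : ℂ) • (fockRep (expUnitary X hX t) x - x) := by
  filter_upwards [self_mem_nhdsWithin] with t ht
  rw [fockGroup_toC0Semigroup_app_apply, max_eq_left (le_of_lt (Set.mem_Ioi.mp ht))]

/-! ## §3  The abstract generator is `⟨genDom, genOp⟩`; the Hamiltonian is `−i · genOp` -/

/-- The explicit Stone generator of `FockStoneGenerator` as a partially defined operator `𝓕_σ →ₗ.[ℂ] 𝓕_σ` (Mathlib `LinearPMap`).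
[folklore] -/
abbrev genPMap {X : Matrix σ σ ℂ} (hX : star X = -X) : FockL2 σ →ₗ.[ℂ] FockL2 σ :=
  ⟨genDom hX, genOp hX⟩

/-- The domain of `genPMap hX` is the Stone domain `genDom hX`. [folklore] -/
@[simp]
theorem genPMap_domain {X : Matrix σ σ ℂ} (hX : star X = -X) : (genPMap hX).domain = genDom hX := rfl

/-- `genPMap hX` acts as `genOp hX`. [folklore] -/
@[simp]
theorem genPMap_apply {X : Matrix σ σ ℂ} (hX : star X = -X) (v : genDom hX) : genPMap hX v = genOp hX v := rfl

/-- For `v ∈ genDom`, the (one-sided) quotient converges to `genOp v`. [folklore] -/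
theorem tendsto_toC0Semigroup_quot_genOp {X : Matrix σ σ ℂ} (hX : star X = -X) (v : genDom hX) :
    Tendsto (fun t : ℝ => ((t⁻¹ : ℝ) : ℂ) •
        ((OneParameterGroup.toC0Semigroup (fockGroup hX).toStrongContRepresentation).app t.toNNReal (v : FockL2 σ)
          - v)) (𝓝[>] 0) (𝓝 (genOp hX v)) := by
  have h := (hasDerivAt_fockRep_expUnitary_iff_tendsto hX _ _).mp (hasDerivAt_fockRep_expUnitary_genOp hX v)
  exact (h.mono_left (nhdsWithin_mono _ fun t ht => Set.mem_compl_singleton_iff.mpr (ne_of_gt ht))).congr'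
    (toC0Semigroup_quot_eventuallyEq hX (v : FockL2 σ)).symm

/-- `genDom hX` is contained in the domain of `OneParameterGroup.generator (fockGroup hX)`.
[folklore] -/
theorem mem_generator_domain_of_mem_genDom {X : Matrix σ σ ℂ} (hX : star X = -X) {x : FockL2 σ}
    (hx : x ∈ genDom hX) :
    x ∈ (OneParameterGroup.generator (fockGroup hX).toStrongContRepresentation).domain :=
  (C0Semigroup.mem_generator_domain_iff _ x).mpr ⟨genOp hX ⟨x, hx⟩, tendsto_toC0Semigroup_quot_genOp hX ⟨x, hx⟩⟩

/-- The domain of `OneParameterGroup.generator (fockGroup hX)` is contained in `genDom hX`.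
[folklore] -/
theorem mem_genDom_of_mem_generator_domain {X : Matrix σ σ ℂ} (hX : star X = -X) {x : FockL2 σ}
    (hx : x ∈ (OneParameterGroup.generator (fockGroup hX).toStrongContRepresentation).domain) :
    x ∈ genDom hX := by
  obtain ⟨y, hy⟩ := (C0Semigroup.mem_generator_domain_iff _ x).mp hx
  exact (mem_genDom_of_hasDerivAt hX
    (hasDerivAt_fockRep_expUnitary_of_tendsto_Ioi hX (hy.congr' (toC0Semigroup_quot_eventuallyEq hX x)))).1

/-- **The domain of the abstract generator is `genDom`** (the finite-energy = differentiable vectors of `FockStoneGenerator`).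
[folklore] -/
theorem generator_fockGroup_domain {X : Matrix σ σ ℂ} (hX : star X = -X) :
    (OneParameterGroup.generator (fockGroup hX).toStrongContRepresentation).domain = genDom hX :=
  le_antisymm (fun _ hx => mem_genDom_of_mem_generator_domain hX hx)
    (fun _ hx => mem_generator_domain_of_mem_genDom hX hx)

/-- … and on it the abstract generator is `genOp`. [folklore] -/
theorem generator_fockGroup_apply {X : Matrix σ σ ℂ} (hX : star X = -X)
    (x : (OneParameterGroup.generator (fockGroup hX).toStrongContRepresentation).domain) :
    OneParameterGroup.generator (fockGroup hX).toStrongContRepresentation x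
      = genOp hX ⟨x, mem_genDom_of_mem_generator_domain hX x.2⟩ :=
  C0Semigroup.generator_apply_eq_of_tendsto _ x
    (tendsto_toC0Semigroup_quot_genOp hX ⟨x, mem_genDom_of_mem_generator_domain hX x.2⟩)

/-- **The abstract generator of `t ↦ ν₀(e^{tX})` is the explicit `⟨genDom, genOp⟩`** as a `LinearPMap`.
[folklore] -/
theorem generator_fockGroup {X : Matrix σ σ ℂ} (hX : star X = -X) :
    OneParameterGroup.generator (fockGroup hX).toStrongContRepresentation = genPMap hX := by
  refine LinearPMap.ext (generator_fockGroup_domain hX) fun x hf hg => ?_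
  rw [generator_fockGroup_apply]
  rfl

/-- **The Hamiltonian** (`UnitaryRep.hamiltonian`, physics convention `U(t) = e^{itH}`) of `t ↦ ν₀(e^{tX})`
is `−i · genOp` on `genDom`. [folklore] -/
theorem hamiltonian_fockGroup {X : Matrix σ σ ℂ} (hX : star X = -X) :
    (fockGroup hX).hamiltonian = (-I) • genPMap hX := by
  rw [UnitaryRep.hamiltonian, generator_fockGroup]

/-- The domain of the Hamiltonian of `fockGroup hX` is `genDom hX`. [folklore] -/
theorem hamiltonian_fockGroup_domain {X : Matrix σ σ ℂ} (hX : star X = -X) :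
    (fockGroup hX).hamiltonian.domain = genDom hX := by
  rw [hamiltonian_fockGroup]
  rfl

/-- Membership form of `hamiltonian_fockGroup_domain`. [folklore] -/
theorem mem_hamiltonian_fockGroup_domain_iff {X : Matrix σ σ ℂ} (hX : star X = -X) (x : FockL2 σ) :
    x ∈ (fockGroup hX).hamiltonian.domain ↔ x ∈ genDom hX := by
  rw [hamiltonian_fockGroup_domain]

/-- The Hamiltonian of `fockGroup hX` acts as `−i · genOp hX`. [folklore] -/
theorem hamiltonian_fockGroup_apply {X : Matrix σ σ ℂ} (hX : star X = -X) {x : FockL2 σ}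
    (hx : x ∈ (fockGroup hX).hamiltonian.domain) :
    (fockGroup hX).hamiltonian ⟨x, hx⟩
      = (-I) • genOp hX ⟨x, (mem_hamiltonian_fockGroup_domain_iff hX x).mp hx⟩ := by
  have h := (LinearPMap.ext_iff.mp (hamiltonian_fockGroup hX)).2 (x := x) (hf := hx)
    (hg := (mem_hamiltonian_fockGroup_domain_iff hX x).mp hx)
  rw [h, LinearPMap.smul_apply]
  rfl

/-! ## §4  The named facts of `UnitaryRep` / `StrongContRepresentation`, PROVED for this group -/

/-- `genDom` is dense (it contains the polynomial core, `denseRange_fockToL2` of `FockCoreDynamics`). [folklore] -/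
theorem dense_genDom {X : Matrix σ σ ℂ} (hX : star X = -X) : Dense (genDom hX : Set (FockL2 σ)) :=
  Dense.mono (Set.range_subset_iff.mpr fun F => fockToL2_mem_genDom hX F)
    (denseRange_fockToL2 (σ := σ) : Dense (Set.range (fockToL2 (σ := σ))))

/-- Conclusion of the named fact `C0Semigroup.dense_generator_domain`, for this group. [folklore] -/
theorem dense_generator_fockGroup_domain {X : Matrix σ σ ℂ} (hX : star X = -X) :
    Dense ((OneParameterGroup.generator (fockGroup hX).toStrongContRepresentation).domain : Set (FockL2 σ)) := by
  rw [generator_fockGroup_domain]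
  exact dense_genDom hX

/-- The Hamiltonian of `fockGroup hX` is densely defined. [folklore] -/
theorem dense_hamiltonian_fockGroup_domain {X : Matrix σ σ ℂ} (hX : star X = -X) :
    Dense ((fockGroup hX).hamiltonian.domain : Set (FockL2 σ)) := by
  rw [hamiltonian_fockGroup_domain]
  exact dense_genDom hX

/-- `⟨genDom, genOp⟩` is a CLOSED operator in Mathlib's sense (`mem_genDom_of_tendsto`, `genOp_eq_of_tendsto` of `FockStoneClosure`).
[folklore] -/
theorem isClosed_genPMap {X : Matrix σ σ ℂ} (hX : star X = -X) : (genPMap hX).IsClosed := by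
  show _root_.IsClosed ((genPMap hX).graph : Set (FockL2 σ × FockL2 σ))
  refine IsSeqClosed.isClosed fun p q hp hq => ?_
  have hv : ∀ n, ∃ v : genDom hX, ((v : FockL2 σ), genOp hX v) = p n := fun n =>
    (LinearPMap.mem_graph_iff' _).mp (hp n)
  choose v hv using hv
  have h1 : Tendsto (fun n => (v n : FockL2 σ)) atTop (𝓝 q.1) :=
    ((continuous_fst.tendsto q).comp hq).congr fun n => by rw [Function.comp_apply, ← hv n]
  have h2 : Tendsto (fun n => genOp hX (v n)) atTop (𝓝 q.2) :=
    ((continuous_snd.tendsto q).comp hq).congr fun n => by rw [Function.comp_apply, ← hv n]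
  have hq1 : q.1 ∈ genDom hX := mem_genDom_of_tendsto hX h1 h2
  have hq2 : genOp hX ⟨q.1, hq1⟩ = q.2 := genOp_eq_of_tendsto hX h1 h2
  rw [SetLike.mem_coe, LinearPMap.mem_graph_iff']
  exact ⟨⟨q.1, hq1⟩, Prod.ext rfl hq2⟩

/-- Conclusion of the named fact `C0Semigroup.isClosed_generator`, for this group. [folklore] -/
theorem isClosed_generator_fockGroup {X : Matrix σ σ ℂ} (hX : star X = -X) :
    (OneParameterGroup.generator (fockGroup hX).toStrongContRepresentation).IsClosed := by
  rw [generator_fockGroup]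
  exact isClosed_genPMap hX

/-- Conclusion of the named fact `OneParameterGroup.mem_generator_domain_iff_two_sided`, for this group:
`x ∈ D(A)` iff the TWO-sided quotient `t⁻¹(U(t)x − x)` converges. [folklore] -/
theorem mem_generator_fockGroup_domain_iff_two_sided {X : Matrix σ σ ℂ} (hX : star X = -X) (x : FockL2 σ) :
    x ∈ (OneParameterGroup.generator (fockGroup hX).toStrongContRepresentation).domain ↔
      ∃ y : FockL2 σ, Tendsto (fun t : ℝ => ((t⁻¹ : ℝ) : ℂ) •
        (OneParameterGroup.app (fockGroup hX).toStrongContRepresentation t x - x)) (𝓝[≠] 0) (𝓝 y) := by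
  rw [generator_fockGroup_domain]
  simp only [fockGroup_app_apply]
  constructor
  · intro hx
    exact ⟨genOp hX ⟨x, hx⟩,
      (hasDerivAt_fockRep_expUnitary_iff_tendsto hX _ _).mp (hasDerivAt_fockRep_expUnitary_genOp hX ⟨x, hx⟩)⟩
  · rintro ⟨y, hy⟩
    exact (mem_genDom_of_hasDerivAt hX ((hasDerivAt_fockRep_expUnitary_iff_tendsto hX x y).mpr hy)).1

/-- Conclusion of the named fact `OneParameterGroup.tendsto_generator_two_sided`, for this group.
[folklore] -/
theorem tendsto_generator_fockGroup_two_sided {X : Matrix σ σ ℂ} (hX : star X = -X)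
    (x : (OneParameterGroup.generator (fockGroup hX).toStrongContRepresentation).domain) :
    Tendsto (fun t : ℝ => ((t⁻¹ : ℝ) : ℂ) •
        (OneParameterGroup.app (fockGroup hX).toStrongContRepresentation t (x : FockL2 σ) - x)) (𝓝[≠] 0)
      (𝓝 (OneParameterGroup.generator (fockGroup hX).toStrongContRepresentation x)) := by
  rw [generator_fockGroup_apply]
  simp only [fockGroup_app_apply]
  exact (hasDerivAt_fockRep_expUnitary_iff_tendsto hX _ _).mp
    (hasDerivAt_fockRep_expUnitary_genOp hX ⟨x, mem_genDom_of_mem_generator_domain hX x.2⟩)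

/-- Conclusion of the named fact `UnitaryRep.hamiltonian_apply_of_hasDerivAt`, for this group: if `t ↦ U(t)ψ` is
differentiable at `0` with derivative `η` then `ψ ∈ D(H)` and `Hψ = −iη` (`mem_genDom_of_hasDerivAt`, `FockStoneGenerator`).
[folklore] -/
theorem hamiltonian_fockGroup_apply_of_hasDerivAt {X : Matrix σ σ ℂ} (hX : star X = -X) {ψ η : FockL2 σ}
    (h : HasDerivAt (fun t : ℝ => (fockGroup hX).appReal t ψ) η 0) :
    ∃ hψ : ψ ∈ (fockGroup hX).hamiltonian.domain, (fockGroup hX).hamiltonian ⟨ψ, hψ⟩ = (-I) • η := by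
  have h' : HasDerivAt (fun t : ℝ => fockRep (expUnitary X hX t) ψ) η 0 := h
  refine ⟨(mem_hamiltonian_fockGroup_domain_iff hX ψ).mpr (mem_genDom_of_hasDerivAt hX h').1, ?_⟩
  rw [hamiltonian_fockGroup_apply, genOp_eq_of_hasDerivAt hX h']

/-! ## §5  Stone's theorem for `t ↦ ν₀(e^{tX})`: the Hamiltonian is self-adjoint -/

/-- `−i · genOp` is symmetric on `genDom` (`inner_genOp_add_inner_genOp`, `FockStoneGenerator`). [folklore] -/
theorem isFormalAdjoint_smul_genPMap {X : Matrix σ σ ℂ} (hX : star X = -X) :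
    ((-I) • genPMap hX).IsFormalAdjoint ((-I) • genPMap hX) := by
  intro x y
  have hskew : ⟪genPMap hX x, (y : FockL2 σ)⟫_ℂ + ⟪(x : FockL2 σ), genPMap hX y⟫_ℂ = 0 :=
    inner_genOp_add_inner_genOp hX ⟨x, x.2⟩ ⟨y, y.2⟩
  rw [LinearPMap.smul_apply, LinearPMap.smul_apply, inner_smul_left (E := FockL2 σ),
    inner_smul_right (E := FockL2 σ), map_neg, Complex.conj_I, neg_neg, eq_neg_of_add_eq_zero_left hskew]
  ring

/-- **Stone's theorem (generator half) for the concrete group `t ↦ ν₀(e^{tX})`, `X ∈ 𝔲(σ)`**: its Hamiltonian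
`H = −i·genOp` on `genDom` is SELF-ADJOINT in Mathlib's `LinearPMap` sense (`H† = H`).  Proof: `H ≤ H†` is the
symmetry above (`LinearPMap.IsFormalAdjoint.le_adjoint`); `H† ≤ H` is the skew-adjointness of `genOp` from `FockStoneClosure`
(`mem_genDom_of_forall_inner_genDom` / `genOp_eq_of_forall_inner_genDom`). [folklore] -/
theorem isSelfAdjoint_hamiltonian_fockGroup {X : Matrix σ σ ℂ} (hX : star X = -X) :
    IsSelfAdjoint (fockGroup hX).hamiltonian := by
  rw [LinearPMap.isSelfAdjoint_def, hamiltonian_fockGroup]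
  set T : FockL2 σ →ₗ.[ℂ] FockL2 σ := (-I) • genPMap hX with hT_def
  have hT : Dense (T.domain : Set (FockL2 σ)) := dense_genDom hX
  have hsymm : T.IsFormalAdjoint T := isFormalAdjoint_smul_genPMap hX
  refine le_antisymm ?_ (hsymm.le_adjoint hT)
  have hadj : T.adjoint.IsFormalAdjoint T := LinearPMap.adjoint_isFormalAdjoint hT
  have key : ∀ y : T.adjoint.domain, ∃ hy : (y : FockL2 σ) ∈ genDom hX, (-I) • genOp hX ⟨y, hy⟩ = T.adjoint y := by
    intro y
    have h : ∀ v : genDom hX, ⟪genOp hX v, (y : FockL2 σ)⟫_ℂ + ⟪(v : FockL2 σ), I • T.adjoint y⟫_ℂ = 0 := by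
      intro v
      have h1 : ⟪T.adjoint y, (v : FockL2 σ)⟫_ℂ = ⟪(y : FockL2 σ), (-I) • genOp hX v⟫_ℂ := by
        have h0 := hadj y ⟨v, v.2⟩
        rwa [LinearPMap.smul_apply] at h0
      rw [inner_smul_right (E := FockL2 σ)] at h1
      have e1 : ⟪genOp hX v, (y : FockL2 σ)⟫_ℂ = conj ⟪(y : FockL2 σ), genOp hX v⟫_ℂ := (inner_conj_symm _ _).symm
      have e2 : ⟪(v : FockL2 σ), I • T.adjoint y⟫_ℂ = I * conj ⟪T.adjoint y, (v : FockL2 σ)⟫_ℂ := by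
        rw [inner_smul_right (E := FockL2 σ), inner_conj_symm]
      rw [e1, e2, h1, map_mul, map_neg, Complex.conj_I, neg_neg, ← mul_assoc, Complex.I_mul_I, neg_one_mul,
        add_neg_cancel]
    exact ⟨mem_genDom_of_forall_inner_genDom hX h, by
      rw [genOp_eq_of_forall_inner_genDom hX h, smul_smul, neg_mul, Complex.I_mul_I, neg_neg, one_smul]⟩
  refine ⟨fun y hy => (key ⟨y, hy⟩).1, fun a b hab => ?_⟩
  obtain ⟨ha, hval⟩ := key a
  rw [← hval, LinearPMap.smul_apply]
  congr 1
  show genOp hX ⟨(a : FockL2 σ), ha⟩ = genOp hX ⟨(b : FockL2 σ), b.2⟩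
  congr 1
  exact Subtype.ext hab

/-- The Hamiltonian of `t ↦ ν₀(e^{tX})` is symmetric (`LinearPMap.IsSymmetric`).
[folklore] -/
theorem isSymmetric_hamiltonian_fockGroup {X : Matrix σ σ ℂ} (hX : star X = -X) :
    (fockGroup hX).hamiltonian.IsSymmetric :=
  (isSelfAdjoint_hamiltonian_fockGroup hX).isSymmetric_linearPMap

/-- The Hamiltonian of `t ↦ ν₀(e^{tX})` is a closed operator. [folklore] -/
theorem isClosed_hamiltonian_fockGroup {X : Matrix σ σ ℂ} (hX : star X = -X) :
    (fockGroup hX).hamiltonian.IsClosed :=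
  (isSelfAdjoint_hamiltonian_fockGroup hX).isClosed

end Literature.Analysis.SegalBargmann
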